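import Summits.ResolutionOfSingularities.ResolutionOfSingularities.Theorems.FrobeniusClosingSteerDivisorTriggerTwoChart
import HarnessLib

/-!
# The divisor trigger at `p = 2` (B1 of res-L0-w41-strat-2's σ-residual HIGH half, part 2/2)

W4.1, crux `Steer` (stmt-ResolutionOfSingularities-16345), σ-line at `p = 2`, regime re-cut §σ2.15/§σ2.16
(res-L0-w41-strat-2, `Sketch-sigma-orders.lean`, `R2TwoSigma-s16-strat2.delta.lean` rev 4 e4924d8597cdaa80;
res-L0-w41-plan-1 RULING 3 2026-08-27T07:20:27Z: B1 `divisorTrigger_two` → res-D-pv-011 AS res-L0-w41-stub-7).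
Theses-free, def-free: the bodies of `IsExcParamAlong` / `IsPermissibleCentre` / `IsTopSingComponent` / `IsSingPrime` /
`RadicandRing` of the skeleton of record (res-L0-w41-lead-1 `Steer_r23.lean` §σ2.1) appear UNFOLDED as binders.

## Statement (B1, one step `R ⊂ R'` of a 2-steered run at a POINT stage)

Let `K` be a field of characteristic `2`, `O` a valuation ring of `K`, `R ⊆ K` a regular local subring dominated by
`O`, `R'` the local blowing up of `R` along its maximal ideal with respect to `O` (`IsLocalBlowupAlong`), regular of
dimension `n ≥ 2`, `x` an exceptional parameter of the step (an element of `𝔪_R` of least value), `s = x·s' + g` with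
`g ∈ R`, `f = s² ∈ R`, `f' = s'² ∈ R'`, such that SOME cleaning of `f` lies in `𝔪_R⁴` (`f − g₀² ∈ 𝔪_R⁴`) and the
generic torsor fibre at the next stage is a field (`s'·b ∉ R'` for `b ∈ R' ∖ 0`). Then the exceptional prime
`(x) ⊂ R'` is a σ_top-PERMISSIBLE centre for `f'` (`exceptional_isPermissibleCentre`); with
`DivisorTrigger.ne_maximalIdeal_of_sigmaTop` (part 1) σ_top does not take the closed point of `R'`, which is strat-2's
`divisorTrigger_two` after unfolding `IsSteeredRun` / `IsPointStep` (adoption leaf kernel-checked against the rev-4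
signature, handed to the holder).

## Proof

`R' = (R[𝔪_R/x])_{centre}` and `x ∉ 𝔪_R²` (domination), so `R'/(x)` is a regular local ring (part 1), a domain of
dimension `dim R' − 1 ≥ 1`: `(x)` is a prime `≠ 𝔪_{R'}` with regular quotient. In characteristic `2`,
`x² f' = f − g² = (f − g₀²) + (g − g₀)²` with `f − g₀² ∈ 𝔪_R⁴ R' = x⁴ R'`; valuations force `g − g₀ ∈ 𝔪_R`, so
`G := (g − g₀)/x ∈ R'` and `f' − G² ∈ (x)²`: the torsor `T² = f'` is SINGULAR at `(x)` (res-type-082's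
`AutoPermissible.singular_atPrime_of_sub_pow_mem_sq`). `(x)` is MINIMAL among singular primes (a prime strictly below
`(x)` is `⊥`, and `⊥` is not singular since `f'` is not a square in `Frac R'`) and TOP-dimensional (every singular
prime `Q` is `≠ ⊥`, so `dim R'/Q = dim R' − ht Q ≤ dim R' − 1 = dim R'/(x)` by the dimension formula in `R'`).
OURS (the W4.1 engine; strat-2 STRAT2-MEMO-1 §3 B1), standard commutative algebra.
[cite: Matsumura1987, Thm. 14.2, Thm. 19.4] [cite: NovacoskiSpivakovsky2014, Def. 2.11]
-/

noncomputable section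

-- `Summit.<S>.<S>.…` duplicates the summit name by design (single-problem summit).
set_option linter.dupNamespace false

open Polynomial IsLocalRing Literature.AlgebraicGeometry.Resolution

namespace Summit.ResolutionOfSingularities.ResolutionOfSingularities.Theorems.SwitchingDichotomy.DivisorTrigger

variable {K : Type} [Field K]

/-! ## §5 The exceptional prime is a σ_top-permissible centre -/

/-- **B1, core: the exceptional prime `(x) ⊂ R'` is σ_top-PERMISSIBLE at the next stage.** One local blowing up
`R ⊂ R'` along `𝔪_R` with respect to `O` (`R` regular local, dominated by `O`; `R'` regular of dimension `n ≥ 2`),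
an exceptional parameter `x` (least value on `𝔪_R`), `s = x·s' + g` (`g ∈ R`), `f = s² ∈ R` with a cleaning in
`𝔪_R⁴`, `f' = s'² ∈ R'` with `s' ∉ Frac R'`, `char K = 2`. Conclusion = the body of the skeleton's
`IsPermissibleCentre R' 2 f' (x)` (with `IsTopSingComponent` / `IsSingPrime` / `RadicandRing` unfolded).
OURS (W4.1 engine, strat-2 STRAT2-MEMO-1 §3 B1). [cite: Matsumura1987, Thm. 14.2, Thm. 19.4]
[cite: NovacoskiSpivakovsky2014, Def. 2.11] -/
theorem exceptional_isPermissibleCentre [CharP K 2] (O : ValuationSubring K) {R R' : Subring K}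
    [IsLocalRing R] [IsLocalRing R'] (hdom : SubringDominates R O.toSubring)
    (hbl : IsLocalBlowupAlong O R (maximalIdeal R) R')
    (hreg : IsRegularLocalRing R) (hreg' : IsRegularLocalRing R') {n : ℕ} (hdim : ringKrullDim R' = n)
    (hn : 2 ≤ n) {x g s s' : K}
    (hx : (∃ hxR : x ∈ R, (⟨x, hxR⟩ : R) ∈ maximalIdeal R) ∧ x ≠ 0 ∧
      ∀ y : R, y ∈ maximalIdeal R → O.valuation (y : K) ≤ O.valuation x)
    (hg : g ∈ R) (hstep : s = x * s' + g) (hs : s ^ 2 ∈ R) (hs' : s' ^ 2 ∈ R')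
    (h4 : ∃ g₀ : R, (⟨s ^ 2, hs⟩ : R) - g₀ ^ 2 ∈ maximalIdeal R ^ 4)
    (hirr : ∀ y z : R', (z : K) ≠ 0 → s' * z ≠ y) :
    ∃ hxR' : x ∈ R',
      Ideal.span {(⟨x, hxR'⟩ : R')} ≠ maximalIdeal R' ∧
      (∃ _ : (Ideal.span {(⟨x, hxR'⟩ : R')}).IsPrime,
        ¬ IsRegularLocalRing (AdjoinRoot (Polynomial.X ^ 2 - Polynomial.C
            (algebraMap R' (Localization.AtPrime (Ideal.span {(⟨x, hxR'⟩ : R')})) ⟨s' ^ 2, hs'⟩))) ∧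
        (∀ (Q : Ideal R') [Q.IsPrime],
          ¬ IsRegularLocalRing (AdjoinRoot (Polynomial.X ^ 2 - Polynomial.C
              (algebraMap R' (Localization.AtPrime Q) ⟨s' ^ 2, hs'⟩))) →
            Q ≤ Ideal.span {(⟨x, hxR'⟩ : R')} → Q = Ideal.span {(⟨x, hxR'⟩ : R')}) ∧
        (∀ (Q : Ideal R') [Q.IsPrime],
          ¬ IsRegularLocalRing (AdjoinRoot (Polynomial.X ^ 2 - Polynomial.C
              (algebraMap R' (Localization.AtPrime Q) ⟨s' ^ 2, hs'⟩))) →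
            (∀ (Q' : Ideal R') [Q'.IsPrime],
              ¬ IsRegularLocalRing (AdjoinRoot (Polynomial.X ^ 2 - Polynomial.C
                  (algebraMap R' (Localization.AtPrime Q') ⟨s' ^ 2, hs'⟩))) →
                Q' ≤ Q → Q' = Q) →
            ringKrullDim (R' ⧸ Q) ≤ ringKrullDim (R' ⧸ Ideal.span {(⟨x, hxR'⟩ : R')}))) ∧
      IsRegularLocalRing (R' ⧸ Ideal.span {(⟨x, hxR'⟩ : R')}) ∧
      ∃ G : R', (⟨s' ^ 2, hs'⟩ : R') - G ^ 2 ∈ Ideal.span {(⟨x, hxR'⟩ : R')} ^ 2 := by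
  classical
  obtain ⟨⟨hxR, hxm⟩, hx0, hmax⟩ := hx
  haveI := hreg
  haveI := hreg'
  have hRO : R ≤ O.toSubring := hdom.1
  have hQT : IsQuadraticTransformAlong O R R' := ⟨‹_›, hbl⟩
  have hle : R ≤ R' := hQT.le
  have hR'O : R' ≤ O.toSubring := hQT.target_le
  have hdom' : SubringDominates R' O.toSubring := hQT.dominated
  -- the chart
  have hR' : R' = locAtCentre (blowupRing R x) O := eq_locAtCentre_blowupRing hbl hxR hxm hx0 hmax
  have hval : ∀ a : R, a ∈ maximalIdeal R ↔ O.valuation (a : K) < 1 :=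
    (subringDominates_valuationSubring_iff hRO).mp hdom
  have hval' : ∀ a : R', a ∈ maximalIdeal R' ↔ O.valuation (a : K) < 1 :=
    (subringDominates_valuationSubring_iff hR'O).mp hdom'
  have hxR' : x ∈ R' := hle hxR
  have hvx : O.valuation x < 1 := (hval ⟨x, hxR⟩).mp hxm
  have hdiv : ∀ y : R, y ∈ maximalIdeal R → (y : K) / x ∈ R' := fun y hy => by
    rw [hR']
    exact le_locAtCentre _ O (div_mem_blowupRing x hy)
  refine ⟨hxR', ?_⟩
  set x' : R' := ⟨x, hxR'⟩ with hx'def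
  set f' : R' := ⟨s' ^ 2, hs'⟩ with hf'def
  set P : Ideal R' := Ideal.span {x'} with hPdef
  have hx'm : x' ∈ maximalIdeal R' := (hval' x').mpr hvx
  have hx'0 : x' ≠ 0 := fun h => hx0 (congrArg Subtype.val h)
  -- §2: `R'/(x)` is a regular local ring
  have hx2 : (⟨x, hxR⟩ : R) ∉ maximalIdeal R ^ 2 :=
    QuadraticStep.not_mem_sq_of_forall_valuation_le hdom (u₀ := ⟨x, hxR⟩) hx0 hmax
  haveI hCreg : IsRegularRing (blowupRing R x ⧸
      Ideal.span {(⟨x, le_blowupRing R x hxR⟩ : blowupRing R x)}) :=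
    isRegularRing_blowupRing_quotient R hxR hxm hx2 hx0
  have hCO : blowupRing R x ≤ O.toSubring :=
    (le_locAtCentre _ O).trans (le_of_eq_of_le hR'.symm hR'O)
  have hregP : IsRegularLocalRing (R' ⧸ P) := by
    have h := isRegularLocalRing_locAtCentre_quotient hCO ⟨x, le_blowupRing R x hxR⟩ hvx
    have key : ∀ (T : Subring K) (hT : T = locAtCentre (blowupRing R x) O) (hxT : x ∈ T),
        IsRegularLocalRing (T ⧸ Ideal.span {(⟨x, hxT⟩ : T)}) := by
      intro T hT hxT
      subst hT
      exact h
    exact key R' hR' hxR'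
  haveI : IsDomain R' := inferInstance
  haveI hPprime : P.IsPrime :=
    (Ideal.Quotient.isDomain_iff_prime P).mp (isDomain_of_isRegularLocalRing _)
  -- dimensions: `dim R'/(x) + 1 = dim R' = n`
  haveI : IsLocalRing (R' ⧸ P) := inferInstance
  obtain ⟨m, hm⟩ := exists_nat_cast_eq_ringKrullDim (R := R' ⧸ P)
  have hmn : m + 1 = n := by
    have h := ringKrullDim_quotient_span_singleton_succ_eq_ringKrullDim_of_mem_nonZeroDivisors
      (mem_nonZeroDivisors_of_ne_zero hx'0) hx'm
    rw [← hPdef, hm, hdim] at h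
    exact_mod_cast h
  -- `(x) ≠ 𝔪_{R'}`
  have hPne : P ≠ maximalIdeal R' := by
    intro hP
    haveI : P.IsMaximal := hP ▸ IsLocalRing.maximalIdeal.isMaximal R'
    have hfield : IsField (R' ⧸ P) := (Ideal.Quotient.maximal_ideal_iff_isField_quotient P).mp ‹_›
    have h0 : ringKrullDim (R' ⧸ P) = 0 := by
      letI := hfield.toField
      exact ringKrullDim_eq_zero_of_isField hfield
    rw [hm] at h0
    have : m = 0 := by exact_mod_cast h0
    omega
  -- §5a: the cleaning `G = (g − g₀)/x` of `f'` into `(x)²`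
  obtain ⟨g₀, hg₀⟩ := h4
  have hmapm : Ideal.map (Subring.inclusion hle) (maximalIdeal R) ≤ P := by
    rw [Ideal.map_le_iff_le_comap]
    intro y hy
    rw [Ideal.mem_comap, hPdef, Ideal.mem_span_singleton']
    refine ⟨⟨(y : K) / x, hdiv y hy⟩, Subtype.ext ?_⟩
    change (y : K) / x * x = y
    rw [div_mul_cancel₀ _ hx0]
  have h4' : Subring.inclusion hle ((⟨s ^ 2, hs⟩ : R) - g₀ ^ 2) ∈ P ^ 4 := by
    refine Ideal.pow_right_mono hmapm 4 ?_
    rw [← Ideal.map_pow]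
    exact Ideal.mem_map_of_mem _ hg₀
  rw [hPdef, Ideal.span_singleton_pow, Ideal.mem_span_singleton'] at h4'
  obtain ⟨h, hh⟩ := h4'
  have hhK : (h : K) * x ^ 4 = s ^ 2 - (g₀ : K) ^ 2 := by
    have e := congrArg Subtype.val hh
    simpa [Subring.coe_mul, Subring.coe_pow] using e
  have hsq : s ^ 2 = x ^ 2 * s' ^ 2 + g ^ 2 := by
    rw [hstep, CharTwo.add_sq, mul_pow]
  -- `(g − g₀)² = x² · w` with `w = h x² − s'² ∈ R'`
  set w : R' := h * x' ^ 2 - f' with hwdef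
  have hwK : (w : K) = (h : K) * x ^ 2 - s' ^ 2 := by
    simp [hwdef, hx'def, hf'def, Subring.coe_mul]
  have hu2 : ((g : K) - (g₀ : K)) ^ 2 = x ^ 2 * (w : K) := by
    rw [sub_pow_char (R := K) g (g₀ : K), hwK]
    linear_combination -hsq - hhK
  -- `g − g₀ ∈ 𝔪_R` (valuations), hence `G := (g − g₀)/x ∈ R'`
  set u : R := ⟨g, hg⟩ - g₀ with hudef
  have huK : (u : K) = g - (g₀ : K) := by simp [hudef]
  have hum : u ∈ maximalIdeal R := by
    rw [hval u]
    by_contra hvu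
    have hvu1 : O.valuation (u : K) = 1 :=
      le_antisymm ((O.valuation_le_one_iff _).mpr (hRO u.2)) (not_lt.mp hvu)
    have hvw : O.valuation (w : K) ≤ 1 := (O.valuation_le_one_iff _).mpr (hR'O w.2)
    have hlt : O.valuation (x ^ 2 * (w : K)) < 1 := by
      rw [map_mul, map_pow]
      calc O.valuation x ^ 2 * O.valuation (w : K) ≤ O.valuation x ^ 2 * 1 :=
            mul_le_mul' le_rfl hvw
        _ < 1 := by
          rw [mul_one]
          exact pow_lt_one₀ zero_le hvx two_ne_zero
    rw [← hu2, map_pow, ← huK, hvu1, one_pow] at hlt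
    exact lt_irrefl _ hlt
  set G : R' := ⟨(u : K) / x, hdiv u hum⟩ with hGdef
  have hGx : (G : K) * x = g - (g₀ : K) := by
    change (u : K) / x * x = _
    rw [div_mul_cancel₀ _ hx0, huK]
  have hG2 : (G : K) ^ 2 = (w : K) := by
    have h1 : ((G : K) * x) ^ 2 = x ^ 2 * (w : K) := by rw [hGx, hu2]
    have hx2K : (x : K) ^ 2 ≠ 0 := pow_ne_zero 2 hx0
    apply mul_left_cancel₀ hx2K
    rw [← h1]
    ring
  have htwo : (2 : K) = 0 := CharTwo.two_eq_zero
  have hclean : f' - G ^ 2 ∈ P ^ 2 := by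
    rw [hPdef, Ideal.span_singleton_pow, Ideal.mem_span_singleton']
    refine ⟨-h, Subtype.ext ?_⟩
    change (((-h : R') : K)) * x ^ 2 = s' ^ 2 - (G : K) ^ 2
    rw [hG2, hwK, Subring.coe_neg]
    linear_combination (-(s' ^ 2)) * htwo
  -- §5b: singular at `(x)`
  have hsing : ¬ IsRegularLocalRing (AdjoinRoot (Polynomial.X ^ 2 - Polynomial.C
      (algebraMap R' (Localization.AtPrime P) f'))) :=
    AutoPermissible.singular_atPrime_of_sub_pow_mem_sq K 2 R' f' P hclean
  -- §5c: `⊥` is not singular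
  have hbot : IsRegularLocalRing (AdjoinRoot (Polynomial.X ^ 2 - Polynomial.C
      (algebraMap R' (Localization.AtPrime (⊥ : Ideal R')) f'))) :=
    isRegularLocalRing_adjoinRoot_bot 2 R' f' s' rfl hirr
  refine ⟨hPne, ⟨hPprime, hsing, ?_, ?_⟩, hregP, G, hclean⟩
  · -- minimality among singular primes
    intro Q _ hQsing hQP
    by_contra hne
    have hQ0 : Q = ⊥ := eq_bot_of_lt_span_singleton hx'm hQP hne
    subst hQ0
    exact hQsing hbot
  · -- top-dimensionality
    intro Q hQ hQsing _
    have hQ0 : Q ≠ ⊥ := by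
      rintro rfl
      exact hQsing hbot
    haveI : Nontrivial (R' ⧸ Q) := Ideal.Quotient.nontrivial_iff.mpr hQ.ne_top
    haveI : IsLocalRing (R' ⧸ Q) := .of_surjective' _ Ideal.Quotient.mk_surjective
    obtain ⟨mQ, hmQ⟩ := exists_nat_cast_eq_ringKrullDim (R := R' ⧸ Q)
    obtain ⟨q, hq⟩ := ENat.ne_top_iff_exists.mp (Q.height_ne_top hQ.ne_top)
    have hform := height_add_ringKrullDim_quotient (S := R') Q
    rw [hmQ, hdim, ← hq] at hform
    have hqm : q + mQ = n := by exact_mod_cast hform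
    have hq1 : 1 ≤ q := by
      have h1 := Ideal.height_add_one_le_of_lt_of_isPrime (bot_lt_iff_ne_bot.mpr hQ0)
      rw [Ideal.height_bot, ← hq, zero_add] at h1
      exact_mod_cast h1
    rw [hmQ, hm]
    have : mQ ≤ m := by omega
    exact_mod_cast this

end Summit.ResolutionOfSingularities.ResolutionOfSingularities.Theorems.SwitchingDichotomy.DivisorTrigger

end
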